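import Literature.NumberTheory.LFunctions.Zhang2022.Section9Statements
import Literature.NumberTheory.LFunctions.Zhang2022.Section8SubstitutionEngine
import HarnessLib

/-!
# Zhang 2022, §9 p. 51 — the integrands of the two displayed `dx/x` integrals are integrable

Y. Zhang, arXiv:2211.02515v1 (2022), §9 p. 51 (tex L2614–L2616): `S_j(𝐚₁₂,𝐚₂₂)` is written with
`∫₁^{P₃} (ῑ₃𝔣_{j6}(P₃/x)/log P₃ + ῑ₄𝔣_{j7}(P₂/x)/log P₂)(ι₃𝔤_{j6}(P₃/x)/log P₃ + ι₄𝔤_{j7}(P₂/x)/log P₂) dx/x` and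
`∫_{P₃}^{P₂} 𝔣_{j7}(P₂/x)𝔤_{j7}(P₂/x) dx/x` (the typed `Section9Statements.int9main` / `int9tail`).  Mathlib's interval integral
is the default `0` for a non-integrable function; these integrands are CONTINUOUS on `(0, ∞)` (`𝔣_{jμ}(y)`, `𝔤_{jμ}(y)` are
elementary functions of `log y` — Lemma 8.2, Lemma 8.4 — and `P₂, P₃ > 0`), and both intervals lie in `(0, ∞)`, so the integrals
are genuine.  No new objects. [cite: Zhang2022LandauSiegel, §9 p.51]
-/

noncomputable section

open Complex Real MeasureTheory ComplexConjugate

namespace Literature.NumberTheory.LFunctions.Zhang2022.Section9Statements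

open Literature.NumberTheory.LFunctions.Zhang2022.Skeleton
open Literature.NumberTheory.LFunctions.Zhang2022.Section8SubstitutionEngine

/-- `P₂ = P^{1/2}T^{−10} > 0`. [cite: Zhang2022LandauSiegel, §2 (2.21)] -/
private theorem P2_pos (D : ℕ) : 0 < Skeleton.P2 D := by
  unfold Skeleton.P2 Skeleton.bigP Skeleton.bigT; positivity

/-- `P₃ = P^{0.498} > 0`. [cite: Zhang2022LandauSiegel, §2 (2.21)] -/
private theorem P3_pos (D : ℕ) : 0 < Skeleton.P3 D := by
  unfold Skeleton.P3 Skeleton.bigP; positivity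

/-- `x ↦ 𝔣_{jμ}(K/x)` is continuous on `(0, ∞)` for `K > 0` (`𝔣_{jμ}(y)` is an elementary function of `log y`, Lemma 8.2).
[cite: Zhang2022LandauSiegel, §8 Lemma 8.2] -/
theorem continuousOn_frakfW_div (c' : ℝ) (D : ℕ) (j μ : ℕ) {K : ℝ} (hK : 0 < K) :
    ContinuousOn (fun x : ℝ => frakfW c' D j μ (K / x)) (Set.Ioi 0) := by
  have hlog : ContinuousOn (fun x : ℝ => Real.log (K / x)) (Set.Ioi 0) :=
    ContinuousOn.log (continuousOn_const.div continuousOn_id fun x hx => ne_of_gt hx) fun x hx => (div_pos hK hx).ne'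
  have hG : Continuous fun t : ℝ => frakfW c' D j μ (rexp (1 * t)) := continuous_frakfW_exp c' D j μ 1
  refine (hG.comp_continuousOn hlog).congr fun x hx => ?_
  simp only [Function.comp_apply, one_mul, Real.exp_log (div_pos hK hx)]

/-- `x ↦ 𝔤_{jμ}(K/x)` is continuous on `(0, ∞)` for `K > 0` (Lemma 8.4). [cite: Zhang2022LandauSiegel, §8 Lemma 8.4] -/
theorem continuousOn_frakgW_div (c' : ℝ) (D : ℕ) (j μ : ℕ) {K : ℝ} (hK : 0 < K) :
    ContinuousOn (fun x : ℝ => frakgW c' D j μ (K / x)) (Set.Ioi 0) := by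
  have hlog : ContinuousOn (fun x : ℝ => Real.log (K / x)) (Set.Ioi 0) :=
    ContinuousOn.log (continuousOn_const.div continuousOn_id fun x hx => ne_of_gt hx) fun x hx => (div_pos hK hx).ne'
  have hG : Continuous fun t : ℝ => frakgW c' D j μ (rexp (1 * t)) := continuous_frakgW_exp c' D j μ 1
  refine (hG.comp_continuousOn hlog).congr fun x hx => ?_
  simp only [Function.comp_apply, one_mul, Real.exp_log (div_pos hK hx)]

/-- The integrand of the tail integral `∫_{P₃}^{P₂} 𝔣_{j7}(P₂/x)𝔤_{j7}(P₂/x) dx/x` is continuous on `(0, ∞)`. [cite: Zhang2022LandauSiegel, §9 p.51, tex L2616] -/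
theorem continuousOn_int9tail_integrand (c' : ℝ) (D : ℕ) (j : ℕ) :
    ContinuousOn (fun x : ℝ => frakfW c' D j 7 (Skeleton.P2 D / x) * frakgW c' D j 7 (Skeleton.P2 D / x) / (x : ℂ)) (Set.Ioi 0) :=
  ((continuousOn_frakfW_div c' D j 7 (P2_pos D)).mul (continuousOn_frakgW_div c' D j 7 (P2_pos D))).div
    Complex.continuous_ofReal.continuousOn fun x hx => by exact_mod_cast (ne_of_gt hx)

/-- Hence the tail integral of `int9tail` is a genuine integral: its integrand is integrable on `[P₃, P₂] ⊂ (0, ∞)`.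
[cite: Zhang2022LandauSiegel, §9 p.51, tex L2616] -/
theorem int9tail_integrable (c' : ℝ) (D : ℕ) (j : ℕ) :
    IntervalIntegrable (fun x : ℝ => frakfW c' D j 7 (Skeleton.P2 D / x) * frakgW c' D j 7 (Skeleton.P2 D / x) / (x : ℂ)) volume (Skeleton.P3 D) (Skeleton.P2 D) :=
  ((continuousOn_int9tail_integrand c' D j).mono fun _ hx =>
    lt_of_lt_of_le (lt_min (P3_pos D) (P2_pos D)) (Set.mem_uIcc.mp hx |>.elim (fun h => (min_le_left _ _).trans h.1) fun h => (min_le_right _ _).trans h.1)).intervalIntegrable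

/-- The integrand of the main integral `∫₁^{P₃} (…)(…) dx/x` of `int9main` is continuous on `(0, ∞)`. [cite: Zhang2022LandauSiegel, §9 p.51, tex L2614–L2615] -/
theorem continuousOn_int9main_integrand (c' : ℝ) (D : ℕ) (j : ℕ) :
    ContinuousOn (fun x : ℝ =>
      (conj iota3 * frakfW c' D j 6 (Skeleton.P3 D / x) / (Real.log (Skeleton.P3 D) : ℂ) +
          conj iota4 * frakfW c' D j 7 (Skeleton.P2 D / x) / (Real.log (Skeleton.P2 D) : ℂ)) *
        (iota3 * frakgW c' D j 6 (Skeleton.P3 D / x) / (Real.log (Skeleton.P3 D) : ℂ) +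
          iota4 * frakgW c' D j 7 (Skeleton.P2 D / x) / (Real.log (Skeleton.P2 D) : ℂ)) / (x : ℂ)) (Set.Ioi 0) := by
  have h6f := continuousOn_frakfW_div c' D j 6 (P3_pos D)
  have h7f := continuousOn_frakfW_div c' D j 7 (P2_pos D)
  have h6g := continuousOn_frakgW_div c' D j 6 (P3_pos D)
  have h7g := continuousOn_frakgW_div c' D j 7 (P2_pos D)
  refine ContinuousOn.div ?_ Complex.continuous_ofReal.continuousOn fun x hx => by exact_mod_cast (ne_of_gt hx)
  exact (((continuousOn_const.mul h6f).div_const _).add ((continuousOn_const.mul h7f).div_const _)).mul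
    (((continuousOn_const.mul h6g).div_const _).add ((continuousOn_const.mul h7g).div_const _))

/-- Hence the main integral of `int9main` is a genuine integral: its integrand is integrable on `[1, P₃] ⊂ (0, ∞)` (whichever of
`1`, `P₃` is larger). [cite: Zhang2022LandauSiegel, §9 p.51, tex L2614–L2615] -/
theorem int9main_integrable (c' : ℝ) (D : ℕ) (j : ℕ) :
    IntervalIntegrable (fun x : ℝ =>
      (conj iota3 * frakfW c' D j 6 (Skeleton.P3 D / x) / (Real.log (Skeleton.P3 D) : ℂ) +
          conj iota4 * frakfW c' D j 7 (Skeleton.P2 D / x) / (Real.log (Skeleton.P2 D) : ℂ)) *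
        (iota3 * frakgW c' D j 6 (Skeleton.P3 D / x) / (Real.log (Skeleton.P3 D) : ℂ) +
          iota4 * frakgW c' D j 7 (Skeleton.P2 D / x) / (Real.log (Skeleton.P2 D) : ℂ)) / (x : ℂ)) volume 1 (Skeleton.P3 D) :=
  ((continuousOn_int9main_integrand c' D j).mono fun _ hx =>
    lt_of_lt_of_le (lt_min one_pos (P3_pos D)) (Set.mem_uIcc.mp hx |>.elim (fun h => (min_le_left _ _).trans h.1) fun h => (min_le_right _ _).trans h.1)).intervalIntegrable

end Literature.NumberTheory.LFunctions.Zhang2022.Section9Statements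

end
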